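import Summits.CriticalPhenomena.CardyFormulaZ2.Theorems.CardyFlipRussoVoronoiHubFromSmirnovDefectLocal
import Summits.CriticalPhenomena.CardyFormulaZ2.Theorems.CardyFlipRussoVoronoiHubFromSmirnovTelescope
import Summits.CriticalPhenomena.CardyFormulaZ2.Theorems.CardyFlipRussoVoronoiHubFromSmirnovChainArmLocalize

/-!
# Consequences of the no-void event (one-arm route, Core C1; lead c3)

Line `moebius-exact-delaunay-dilation-ward` of crux `VoronoiHubFromSmirnov` (stmt-CriticalPhenomena-6433).
On the event "every point of the compact `Kc` (physical) has a black nucleus within `r_v` at mesh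
`δ`", and given the bi-Lipschitz package of the transport map `g` on small physical balls
(`transport_bilipschitz`) and the injectivity modulus on `Kc` (`hub_uniform_injOn`), we derive, in
configuration coordinates: no voids among the WINDOWED nuclei near deep points; no voids among
their transported images; the step bound `dist p q ≤ u` for adjacent pairs of either adjacency
(`stepGood`); the localisation of chain arms to annular bands (`ChainArm` for the band-windowed
adjacency); and — the main point — that a defective square forces one of four LOCAL potential-defect
events (near-tied navel / close pair, for the nuclei near the square or for their transported
images), by the landed `potDef_of_euc_not_pull` / `potDef_of_pull_not_euc` fed with the uniform
Lemma-4.2 packages of `g` and of its inverse.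
-/

noncomputable section

namespace Summit.CriticalPhenomena.CardyFormulaZ2.Cruxes.VoronoiHubFromSmirnov.MoebiusExactDelaunayDilationWard

open Set Metric
open Literature.Analysis.FunctionSpaces
open Literature.Probability.LatticeModels (IsDelaunayPair voronoiCell)

section Setting

/-! ### The setting of one mesh

`δ` the mesh, `r_v` the no-void radius (configuration coordinates), `g` the transport map with
bi-Lipschitz constant `Λ ≥ 1` on physical balls of radius `r` centred in `Kc ⊇ V`, `η` its
injectivity modulus on `Kc` at physical distance `r/2`, `c` the configuration (black, white). -/

variable {g : ℂ → ℂ} {V Kc : Set ℂ} {δ r_v Λ r η m₁ : ℝ} {c : PointConfig ℂ × PointConfig ℂ}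

/-- The transport map in terms of `g`: `δ · T b = g (δ b)`. -/
theorem vc_mul_transportMap (hδ : 0 < δ) (b : ℂ) :
    (δ : ℂ) * transportMap g δ b = g ((δ : ℂ) * b) :=
  (f_mul_eq hδ g b).symm

/-- Distances of transported points are physical image distances divided by the mesh. -/
theorem vc_dist_transportMap (hδ : 0 < δ) (x y : ℂ) :
    dist (transportMap g δ x) (transportMap g δ y) =
      δ⁻¹ * dist (g ((δ : ℂ) * x)) (g ((δ : ℂ) * y)) := by
  have h := dist_real_mul δ hδ (transportMap g δ x) (transportMap g δ y)
  rw [vc_mul_transportMap (g := g) hδ, vc_mul_transportMap (g := g) hδ] at h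
  rw [h, ← mul_assoc, inv_mul_cancel₀ hδ.ne', one_mul]

/-- **Windowed no-void near a deep point.**  If every point of `Kc ⊇ V` has a black nucleus within
`r_v` (read at mesh `δ`) and the physical ball of radius `m₁` about `δ p` lies in `V`, then every
configuration point within `m₁/δ − r_v` of `p` has a WINDOWED black nucleus within `r_v`. -/
theorem vc_window_noVoid (hδ : 0 < δ) (hrv : 0 ≤ r_v) (hVKc : V ⊆ Kc)
    (hvoid : ∀ z ∈ Kc, ∃ x ∈ (c.1 : Set ℂ), dist x (z / (δ : ℂ)) < r_v) {p : ℂ}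
    (hdeep : closedBall ((δ : ℂ) * p) m₁ ⊆ V) {w : ℂ} (hw : dist w p ≤ m₁ / δ - r_v) :
    ∃ y ∈ (c.1 : Set ℂ) ∩ {b : ℂ | (δ : ℂ) * b ∈ V}, dist y w < r_v := by
  have hδ' : (δ : ℂ) ≠ 0 := Complex.ofReal_ne_zero.2 hδ.ne'
  have hwp : dist w p ≤ m₁ / δ := by linarith
  have hwV : (δ : ℂ) * w ∈ V := hdeep (by
    rw [mem_closedBall, dist_real_mul δ hδ]
    calc δ * dist w p ≤ δ * (m₁ / δ) := mul_le_mul_of_nonneg_left hwp hδ.le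
      _ = m₁ := mul_div_cancel₀ _ hδ.ne')
  obtain ⟨x, hx, hxw⟩ := hvoid _ (hVKc hwV)
  rw [mul_div_cancel_left₀ _ hδ'] at hxw
  refine ⟨x, ⟨hx, hdeep ?_⟩, hxw⟩
  rw [mem_closedBall, dist_real_mul δ hδ]
  have h1 : dist x p ≤ dist x w + dist w p := dist_triangle _ _ _
  have h2 : δ * dist x p ≤ δ * (m₁ / δ) := mul_le_mul_of_nonneg_left (by linarith) hδ.le
  rwa [mul_div_cancel₀ _ hδ.ne'] at h2

/-- **Image no-void near a deep point.**  Under the local surjectivity and the upper Lipschitz bound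
of `g` on the physical ball `closedBall (δ p) r`, every point within `ρ'` of `T p` on the image
side has the image of a windowed black nucleus within `Λ r_v`, that nucleus lying within
`Λ² ρ' + r_v` of `p` — provided the scales fit in the ball and in the window. -/
theorem vc_image_noVoid (hδ : 0 < δ) (hrv : 0 ≤ r_v) (hΛ : 1 ≤ Λ) (hVKc : V ⊆ Kc)
    (hvoid : ∀ z ∈ Kc, ∃ x ∈ (c.1 : Set ℂ), dist x (z / (δ : ℂ)) < r_v) {p : ℂ}
    (hdeep : closedBall ((δ : ℂ) * p) m₁ ⊆ V)
    (hup : ∀ z ∈ closedBall ((δ : ℂ) * p) r, ∀ w ∈ closedBall ((δ : ℂ) * p) r,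
      dist (g z) (g w) ≤ Λ * dist z w)
    (hsurj : ∀ ρ : ℝ, 0 ≤ ρ → Λ * ρ ≤ r →
      closedBall (g ((δ : ℂ) * p)) ρ ⊆ g '' closedBall ((δ : ℂ) * p) (Λ * ρ))
    {ρ' : ℝ} (hρ' : 0 ≤ ρ') (hfit : δ * (Λ ^ 2 * ρ' + r_v) ≤ r) (hfit' : Λ ^ 2 * ρ' + r_v ≤ m₁ / δ - r_v)
    {w' : ℂ} (hw' : dist w' (transportMap g δ p) ≤ ρ') :
    ∃ y ∈ (c.1 : Set ℂ) ∩ {b : ℂ | (δ : ℂ) * b ∈ V}, dist y p ≤ Λ ^ 2 * ρ' + r_v ∧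
      dist (transportMap g δ y) w' < Λ * r_v := by
  have hδ' : (δ : ℂ) ≠ 0 := Complex.ofReal_ne_zero.2 hδ.ne'
  have hΛ0 : 0 < Λ := lt_of_lt_of_le one_pos hΛ
  have hrv0 : 0 ≤ r_v := hrv
  have hΛΛ : Λ * ρ' ≤ Λ ^ 2 * ρ' := by
    nlinarith [mul_nonneg (mul_nonneg hΛ0.le hρ') (sub_nonneg.2 hΛ)]
  -- the physical point `δ w'` is within `δ Λ ρ'`… precisely within `δ ρ'` of `g (δ p)`
  have hphys : dist ((δ : ℂ) * w') (g ((δ : ℂ) * p)) ≤ δ * ρ' := by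
    rw [← vc_mul_transportMap (g := g) hδ p, dist_real_mul δ hδ]
    exact mul_le_mul_of_nonneg_left hw' hδ.le
  -- local surjectivity: a physical preimage `z₀` within `Λ δ ρ'` of `δ p`
  have hΛρ : Λ * (δ * ρ') ≤ r := by
    have h1 : Λ * (δ * ρ') = δ * (Λ * ρ') := by ring
    have h2 : δ * (Λ * ρ') ≤ δ * (Λ ^ 2 * ρ' + r_v) :=
      mul_le_mul_of_nonneg_left (by linarith) hδ.le
    linarith
  obtain ⟨z₀, hz₀, hgz₀⟩ := hsurj (δ * ρ') (by positivity) hΛρ (mem_closedBall.2 hphys)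
  set z : ℂ := z₀ / (δ : ℂ) with hz
  have hzz : (δ : ℂ) * z = z₀ := by rw [hz, mul_div_cancel₀ _ hδ']
  have hzp : dist z p ≤ Λ * ρ' := by
    have h := mem_closedBall.1 hz₀
    rw [← hzz, dist_real_mul δ hδ] at h
    nlinarith [h, hδ]
  -- no void at `z`
  have hzw : dist z p ≤ m₁ / δ - r_v := by linarith
  obtain ⟨y, hy, hyz⟩ := vc_window_noVoid hδ hrv hVKc hvoid hdeep hzw
  refine ⟨y, hy, ?_, ?_⟩
  · calc dist y p ≤ dist y z + dist z p := dist_triangle _ _ _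
      _ ≤ r_v + Λ * ρ' := by linarith [hyz.le]
      _ ≤ Λ ^ 2 * ρ' + r_v := by linarith
  · -- `T z = w'` and the upper Lipschitz bound
    have hTz : transportMap g δ z = w' := by
      rw [transportMap, hzz, hgz₀, mul_div_cancel_left₀ _ hδ']
    rw [← hTz, vc_dist_transportMap hδ]
    have hyball : (δ : ℂ) * y ∈ closedBall ((δ : ℂ) * p) r := by
      rw [mem_closedBall, dist_real_mul δ hδ]
      have : dist y p ≤ Λ ^ 2 * ρ' + r_v := by
        calc dist y p ≤ dist y z + dist z p := dist_triangle _ _ _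
          _ ≤ r_v + Λ * ρ' := by linarith [hyz.le]
          _ ≤ Λ ^ 2 * ρ' + r_v := by linarith
      exact (mul_le_mul_of_nonneg_left this hδ.le).trans hfit
    have hzball : (δ : ℂ) * z ∈ closedBall ((δ : ℂ) * p) r := by
      rw [hzz]; exact closedBall_subset_closedBall hΛρ hz₀
    have hL := hup _ hyball _ hzball
    rw [dist_real_mul δ hδ] at hL
    calc δ⁻¹ * dist (g ((δ : ℂ) * y)) (g ((δ : ℂ) * z)) ≤ δ⁻¹ * (Λ * (δ * dist y z)) :=
          mul_le_mul_of_nonneg_left hL (inv_nonneg.2 hδ.le)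
      _ = Λ * dist y z := by field_simp
      _ < Λ * r_v := mul_lt_mul_of_pos_left hyz hΛ0

/-! ### Step bounds for adjacent pairs -/

/-- **Euclidean neighbours are close** on the no-void event: `2 r_v`. -/
theorem vc_dist_le_of_adjEuc (hδ : 0 < δ) (hrv : 0 < r_v) (hVKc : V ⊆ Kc)
    (hvoid : ∀ z ∈ Kc, ∃ x ∈ (c.1 : Set ℂ), dist x (z / (δ : ℂ)) < r_v) {p q : ℂ}
    (hdeep : closedBall ((δ : ℂ) * p) m₁ ⊆ V) (hfit : 2 * r_v ≤ m₁ / δ - r_v)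
    (h : adjEuc {b : ℂ | (δ : ℂ) * b ∈ V} c p q) : dist q p ≤ 2 * r_v := by
  refine dist_le_of_isDelaunayPair_noVoid hrv h fun w hw => ?_
  obtain ⟨y, hy, hyw⟩ := vc_window_noVoid hδ hrv.le hVKc hvoid hdeep (hw.trans hfit)
  exact ⟨y, Or.inl hy, hyw⟩

/-- **Pulled-back neighbours are close** on the no-void event: `2 Λ² r_v` (image no-void at scale
`Λ r_v`, then the injectivity modulus and the lower Lipschitz bound bring the pair back). -/
theorem vc_dist_le_of_adjPull (hδ : 0 < δ) (hrv : 0 < r_v) (hΛ : 1 ≤ Λ) (hVKc : V ⊆ Kc)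
    (hvoid : ∀ z ∈ Kc, ∃ x ∈ (c.1 : Set ℂ), dist x (z / (δ : ℂ)) < r_v) {p q : ℂ}
    (hpKc : (δ : ℂ) * p ∈ Kc) (hqKc : (δ : ℂ) * q ∈ Kc) (hdeep : closedBall ((δ : ℂ) * p) m₁ ⊆ V)
    (hup : ∀ z ∈ closedBall ((δ : ℂ) * p) r, ∀ w ∈ closedBall ((δ : ℂ) * p) r,
      dist (g z) (g w) ≤ Λ * dist z w)
    (hlow : ∀ z ∈ closedBall ((δ : ℂ) * p) r, ∀ w ∈ closedBall ((δ : ℂ) * p) r,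
      dist z w ≤ Λ * dist (g z) (g w))
    (hsurj : ∀ ρ : ℝ, 0 ≤ ρ → Λ * ρ ≤ r →
      closedBall (g ((δ : ℂ) * p)) ρ ⊆ g '' closedBall ((δ : ℂ) * p) (Λ * ρ))
    (hmod : ∀ z ∈ Kc, ∀ w ∈ Kc, r / 2 ≤ dist z w → η ≤ dist (g z) (g w))
    (hη : δ * (2 * Λ * r_v) < η) (hr2 : r / 2 ≤ r)
    (hfit : δ * (Λ ^ 2 * (2 * Λ * r_v) + r_v) ≤ r)
    (hfit' : Λ ^ 2 * (2 * Λ * r_v) + r_v ≤ m₁ / δ - r_v)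
    (h : adjPull g V δ c p q) : dist q p ≤ 2 * Λ ^ 2 * r_v := by
  have hΛ0 : 0 < Λ := lt_of_lt_of_le one_pos hΛ
  -- image-side bound `dist (T q) (T p) ≤ 2 Λ r_v`
  have himg : dist (transportMap g δ q) (transportMap g δ p) ≤ 2 * (Λ * r_v) := by
    refine dist_le_of_isDelaunayPair_noVoid (mul_pos hΛ0 hrv) h fun w' hw' => ?_
    have hw'' : dist w' (transportMap g δ p) ≤ 2 * Λ * r_v := by linarith
    obtain ⟨y, hy, -, hyw⟩ := vc_image_noVoid hδ hrv.le hΛ hVKc hvoid hdeep hup hsurj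
      (by positivity) hfit hfit' hw''
    exact ⟨transportMap g δ y, Or.inl ⟨y, hy, rfl⟩, hyw⟩
  -- physical image distance `< η`, hence the pair is `r/2`-close, hence in the Lipschitz ball
  have hphys : dist (g ((δ : ℂ) * q)) (g ((δ : ℂ) * p)) ≤ δ * (2 * Λ * r_v) := by
    have := vc_dist_transportMap (g := g) hδ q p
    rw [this] at himg
    have h2 := mul_le_mul_of_nonneg_left himg hδ.le
    rw [← mul_assoc, mul_inv_cancel₀ hδ.ne', one_mul] at h2
    linarith
  have hclose : dist ((δ : ℂ) * q) ((δ : ℂ) * p) < r / 2 := by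
    by_contra hfar
    push Not at hfar
    have := hmod _ hqKc _ hpKc hfar
    linarith
  have hqball : (δ : ℂ) * q ∈ closedBall ((δ : ℂ) * p) r := mem_closedBall.2 (by linarith)
  have hpball : (δ : ℂ) * p ∈ closedBall ((δ : ℂ) * p) r := mem_closedBall_self (by linarith)
  have hL := hlow _ hqball _ hpball
  rw [dist_real_mul δ hδ] at hL
  have : δ * dist q p ≤ δ * (2 * Λ ^ 2 * r_v) := by nlinarith [hL, hphys, hΛ0]
  exact le_of_mul_le_mul_left this hδ

/-- **The step-good event holds on the no-void event** (both adjacencies), once `u ≥ 2 Λ² r_v`. -/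
theorem vc_stepGood (hδ : 0 < δ) (hrv : 0 < r_v) (hΛ : 1 ≤ Λ) (hVKc : V ⊆ Kc) {u : ℝ}
    (hu : 2 * Λ ^ 2 * r_v ≤ u) {K : Set ℂ} (hKKc : K ⊆ Kc) (hKdeep : ∀ x ∈ K, closedBall x m₁ ⊆ V)
    (hup : ∀ x ∈ Kc, ∀ z ∈ closedBall x r, ∀ w ∈ closedBall x r, dist (g z) (g w) ≤ Λ * dist z w)
    (hlow : ∀ x ∈ Kc, ∀ z ∈ closedBall x r, ∀ w ∈ closedBall x r, dist z w ≤ Λ * dist (g z) (g w))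
    (hsurj : ∀ x ∈ Kc, ∀ ρ : ℝ, 0 ≤ ρ → Λ * ρ ≤ r →
      closedBall (g x) ρ ⊆ g '' closedBall x (Λ * ρ))
    (hmod : ∀ z ∈ Kc, ∀ w ∈ Kc, r / 2 ≤ dist z w → η ≤ dist (g z) (g w))
    (hη : δ * (2 * Λ * r_v) < η) (hr : 0 < r)
    (hfit : δ * (Λ ^ 2 * (2 * Λ * r_v) + r_v) ≤ r)
    (hfit' : Λ ^ 2 * (2 * Λ * r_v) + r_v ≤ m₁ / δ - r_v)
    (hvoid : ∀ z ∈ Kc, ∃ x ∈ (c.1 : Set ℂ), dist x (z / (δ : ℂ)) < r_v) :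
    c ∈ stepGood u {b : ℂ | (δ : ℂ) * b ∈ V} g V δ K := by
  have hΛ0 : 0 < Λ := lt_of_lt_of_le one_pos hΛ
  have hΛ2 : (1 : ℝ) ≤ Λ ^ 2 := one_le_pow₀ hΛ
  have hΛ3 : (1 : ℝ) ≤ Λ ^ 2 * Λ := one_le_mul_of_one_le_of_one_le hΛ2 hΛ
  have h2rv : 2 * r_v ≤ 2 * Λ ^ 2 * r_v := by
    have := mul_le_mul_of_nonneg_left hΛ2 (by positivity : (0 : ℝ) ≤ 2 * r_v)
    linarith
  have h2rv' : 2 * r_v ≤ Λ ^ 2 * (2 * Λ * r_v) := by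
    have := mul_le_mul_of_nonneg_left hΛ3 (by positivity : (0 : ℝ) ≤ 2 * r_v)
    linarith
  intro p q _ _ hpK hqK hadj
  have hfit₁ : 2 * r_v ≤ m₁ / δ - r_v := by linarith
  rcases hadj with h | h
  · have := vc_dist_le_of_adjEuc hδ hrv hVKc hvoid (hKdeep _ hpK) hfit₁ h
    rw [dist_comm]; linarith
  · have := vc_dist_le_of_adjPull hδ hrv hΛ hVKc hvoid (hKKc hpK) (hKKc hqK) (hKdeep _ hpK)
      (hup _ (hKKc hpK)) (hlow _ (hKKc hpK)) (hsurj _ (hKKc hpK)) hmod hη (by linarith) hfit hfit' h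
    rw [dist_comm]; linarith

/-! ### Localising chain arms -/

/-- Chain arms are monotone in the adjacency relation (registered glue sub-goal, ∀-form). -/
theorem chainArm_mono_adj : ∀ (E E' : ℂ → ℂ → Prop) (z : ℂ) (r₁ r₂ : ℝ) (K : Set ℂ) (δ : ℝ) (b : Set ℂ), (∀ p q : ℂ, p ∈ b → q ∈ b → E p q → E' p q) → ChainArm E z r₁ r₂ K δ b → ChainArm E' z r₁ r₂ K δ b := by
  intro E E' z r₁ r₂ K δ b hEE' h
  obtain ⟨N, p, hb, hK, h0, hN, hE⟩ := h
  exact ⟨N, p, hb, hK, h0, hN, fun i => hEE' _ _ (hb _) (hb _) (hE i)⟩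

/-- Chain arms are monotone in the adjacency relation. -/
theorem ChainArm.mono_adj {E E' : ℂ → ℂ → Prop} {z : ℂ} {r₁ r₂ : ℝ} {K : Set ℂ} {δ : ℝ} {b : Set ℂ}
    (hEE' : ∀ p q, p ∈ b → q ∈ b → E p q → E' p q) (h : ChainArm E z r₁ r₂ K δ b) :
    ChainArm E' z r₁ r₂ K δ b := by
  obtain ⟨N, p, hb, hK, h0, hN, hE⟩ := h
  exact ⟨N, p, hb, hK, h0, hN, fun i => hEE' _ _ (hb _) (hb _) (hE i)⟩

/-- **Localisation of chain arms** on the step-good event: an arm for the window adjacency gives an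
arm for the adjacency read in the annular band `D ⊆ window` (fewer nuclei keep empty discs empty),
with all its points in the thinner band `D'` (`chainArm_localize` with the step bound `u`). -/
theorem vc_armLoc_of_chainArm {u : ℝ} (hu : 0 ≤ u) {W D D' K : Set ℂ} {z : ℂ} {r₁ r₂ : ℝ}
    (hr : r₁ < r₂) (hDW : D ⊆ W)
    (hD' : D' = {x : ℂ | r₁ - u ≤ dist x z ∧ dist x z ≤ r₂ + u})
    (hstep : ∀ p q : ℂ, p ∈ (c.1 : Set ℂ) → q ∈ (c.1 : Set ℂ) → (δ : ℂ) * p ∈ K → (δ : ℂ) * q ∈ K →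
      adjEuc W c p q → dist p q ≤ u)
    (h : ChainArm (adjEuc W c) z r₁ r₂ K δ (c.1 : Set ℂ)) :
    ChainArm (adjEuc D c) z r₁ r₂ K δ ((c.1 : Set ℂ) ∩ D') := by
  have hloc := chainArm_localize (adjEuc W c) z r₁ r₁ r₂ r₂ u K δ (c.1 : Set ℂ) hu h le_rfl hr le_rfl
    hstep
  rw [← hD'] at hloc
  refine ChainArm.mono_adj (fun p q _ _ hpq => ?_) hloc
  refine IsDelaunayPair.anti ?_ hpq
  exact union_subset_union (inter_subset_inter_right _ hDW) (inter_subset_inter_right _ hDW)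

end Setting

end Summit.CriticalPhenomena.CardyFormulaZ2.Cruxes.VoronoiHubFromSmirnov.MoebiusExactDelaunayDilationWard

end
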